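import Summits.Ventures.YMGap.RobustBall.PlaquetteLeadingCoefficient
import Summits.Ventures.YMGap.RobustBall.StringTensionSharp
import HarnessLib

/-!
# Robust ball (Y2), area-law side — the string-tension CEILING WITHOUT AN ADDITIVE CONSTANT, for every `SU(N)`

HONEST FRAMING: venture file of the cell `pub-ymgap` (QuantumFields programme), track ROBUST-BALL, seat rb-p2 (g6); file 2 of 2 (the abstract bounds
`rectExpectation_one_one_ge_sum/_linear`, `stringTension_le_log_linear_of_model` are in `PlaquetteLeadingCoefficient`).  LATTICE
statements about the infinite-volume limit states (`infiniteVolumeLimitPoints`) of the `SU(N)` torus Wilson states at tree coupling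
`β` (`= β_W/N`); `σ(μ) = stringTension μ χ_N` exists at every `β > 0` for the Wilson member (`WilsonStringTension.stringTension_le`,
reflection positivity).  WHAT IS NEW.  The plaquette floor of rb-p2 g3/g5, `W_μ(1,1) ≥ u · e^{−8nNβ}/(2n)` (`u = βV₀/N`,
dimension `n + 1`), lost the factor `1/(2n)` = «the plaquette floor shares `∑_{p ∋ e}` over the `2n` plaquettes through a link»,
i.e. an additive `log(2n)` on the ceiling side of the strong-coupling law.  The per-link first moment of `PlaquetteFirstMoment`
(sequential resampling of one private link per plaquette) removes it:
* every `G ≅ SU(N)`, `N ≥ 2`, `d = n + 1 ≥ 2`, every `β > 0`, every limit state (`rectExpectation_one_one_ge_sum/_linear`):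
  `W_μ(1,1) ≥ u · e^{−D} · (1/2n) ∑_{k=1}^{2n} e^{−kD} ≥ u · e^{−2n(2n+3)Nβ}`, `D = 4nNβ`, with `u = βV₀/N` THE EXACT LEADING
  COEFFICIENT of the strong-coupling series (`β_W/4` for `SU(2)`, `β_W/(2N²)` for `N ≥ 3`; `V₀` from `HaarSecondMoments`);
* hence the CEILING `σ(μ) ≤ −log W_μ(1,1) ≤ log(1/u) + 2n(2n+3)Nβ` with NO additive constant (`stringTension_le_log_linear_of_model`):
  ★★ `SU(2)`: `σ(μ) ≤ log(4/β_W) + 2n(2n+3)β_W` at EVERY `β_W > 0` (`d = 4`: `log(4/β_W) + 54β_W`; `d = 3`: `+ 28β_W`);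
  every `N ≥ 2`: `σ(μ) ≤ log(2N/β) + 2n(2n+3)Nβ`; `SU(3)`, `d = 4`: `σ(μ) ≤ log(18/β_W) + 54β_W`;
* ★★ the `SU(2)`, `d = 4` law becomes `log(4/β_W) − log 6 ≤ σ(μ) ≤ log(4/β_W) + 54β_W` on `0 < β_W ≤ 2/3`
  (`su2_stringTension_two_sided_linear_dim4`): the deviation above Wilson's leading term is `O(β_W)` — as `β_W → 0` the ceiling-side
  loss VANISHES (`su2_stringTension_ceiling_limit_dim4`: `∀ ε > 0 ∃ β₀ > 0 ∀ β_W ≤ β₀ ∀ μ, σ(μ) ≤ log(4/β_W) + ε`), the remaining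
  `log 6 = log(2n)` below is the Dobrushin door's alone; joined with g5: `σ(μ) − log(4/β_W) ≤ min(log 6 + 24β_W, 54β_W)`;
* the static quark potential: `V_μ(R) ≤ (log(4/β_W) + 2n(2n+3)β_W)·R` (`SU(2)`), two-sided at `d = 4`.
WHAT IT IS NOT: the `β`-coefficients are one-link artefacts (the series' `O(β_W²)` is not claimed); `σ`-existence is the Wilson
member's; nothing continuum / spectral / Clay.  0 compute.

References: K. Wilson, Phys. Rev. D 10 (1974) 2445; E. Seiler, LNP 159 (1982) §2; M. Creutz, *Quarks, gluons and lattices* (1983)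
§8–§10 (for comparison only).  Everything here is proved. [folklore]
-/

noncomputable section

open MeasureTheory Filter Topology Finset
open Literature.MathematicalPhysics.QuantumLattice
open Literature.MathematicalPhysics.QuantumFieldTheory hiding ZdEdge Site

namespace Summit.Ventures.YMGap.RobustBall

namespace StringTensionExplicit

/-! ### `SU(N)`, dimension `n + 1`: every-`N` ceiling `log(2N/β) + 2n(2n+3)Nβ` -/

variable {n N : ℕ}

/-- ★ **Every `N ≥ 2`, dimension `n + 1 ≥ 2`, every `β > 0`, every infinite-volume limit state**:
`−log W_μ(1,1), σ(μ) ≤ log(2N/β) + 2n(2n+3)Nβ` (`V₀ ≥ 1/2`; for `N ≥ 3`, `log(2N/β) = log(2N²/β_W) = log(1/u)` exactly). [folklore] -/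
theorem suN_stringTension_le_log_linear (hN : 2 ≤ N) (hn : 1 ≤ n) {β : ℝ} (hβ : 0 < β) {μ : Measure (LGConfig (n + 1) (SUN N))}
    (hμ : haveI : NeZero (n + 1) := ⟨by omega⟩; μ ∈ infiniteVolumeLimitPoints (fundamentalRep (Fin N)) β) :
    haveI : NeZero (n + 1) := ⟨by omega⟩
    (-Real.log (rectExpectation μ (fun g => normalisedCharacter N (fundamentalRep (Fin N) g)) 0 1 1 1) ≤
        Real.log (2 * N / β) + 2 * n * (2 * n + 3) * N * β) ∧
      stringTension μ (fun g => normalisedCharacter N (fundamentalRep (Fin N) g)) ≤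
        Real.log (2 * N / β) + 2 * n * (2 * n + 3) * N * β := by
  haveI : NeZero (n + 1) := ⟨by omega⟩
  have hρ := TorusAreaLaw.isSpecialUnitaryModel_fundamentalRep N
  have h1 := neg_log_plaquette_le_linear_of_model (d := n + 1) (fundamentalRep (Fin N)) hρ hN (by omega) hβ hμ
  obtain ⟨-, -, hle, -⟩ := WilsonStringTension.stringTension_le (d := n + 1) (fundamentalRep (Fin N)) hρ hN (by omega) hβ hμ
  have hV := HaarSecondMoments.half_le_charVariance (fundamentalRep (Fin N)) hρ hN
  have hN0 : (0 : ℝ) < N := by exact_mod_cast (show 0 < N by omega)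
  have hd : ((n + 1 : ℕ) : ℝ) - 1 = n := by push_cast; ring
  have hd' : (2 : ℝ) * ((n + 1 : ℕ) : ℝ) + 1 = 2 * n + 3 := by push_cast; ring
  rw [hd, hd'] at h1
  have hlog : Real.log (N / (β * PlaquetteLowerBound.charVariance (fundamentalRep (Fin N)))) ≤ Real.log (2 * N / β) := by
    refine Real.log_le_log (by positivity) ?_
    rw [div_le_div_iff₀ (by positivity) hβ]
    have hkey : (N : ℝ) * β * (1 / 2) ≤ (N : ℝ) * β * PlaquetteLowerBound.charVariance (fundamentalRep (Fin N)) :=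
      mul_le_mul_of_nonneg_left hV (le_of_lt (mul_pos hN0 hβ))
    calc (N : ℝ) * β = 2 * ((N : ℝ) * β * (1 / 2)) := by ring
      _ ≤ 2 * ((N : ℝ) * β * PlaquetteLowerBound.charVariance (fundamentalRep (Fin N))) := by linarith
      _ = 2 * N * (β * PlaquetteLowerBound.charVariance (fundamentalRep (Fin N))) := by ring
  refine ⟨by linarith, hle.trans (by linarith)⟩

/-- ★ **Every `N ≥ 2`, `d = 4`: `σ(μ) ≤ log(2N/β) + 54Nβ`** at every `β > 0`, every infinite-volume limit state. [folklore] -/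
theorem suN_stringTension_le_log_linear_dim4 (hN : 2 ≤ N) {β : ℝ} (hβ : 0 < β) {μ : Measure (LGConfig 4 (SUN N))}
    (hμ : μ ∈ infiniteVolumeLimitPoints (fundamentalRep (Fin N)) β) :
    stringTension μ (fun g => normalisedCharacter N (fundamentalRep (Fin N) g)) ≤ Real.log (2 * N / β) + 54 * N * β := by
  obtain ⟨-, h⟩ := suN_stringTension_le_log_linear (n := 3) hN (by norm_num) hβ hμ
  push_cast at h
  linarith

/-- ★ **Every `N ≥ 3`, dimension `n + 1`, the TWO-SIDED law around the exact leading term `log(2N/β) = log(2N²/β_W)`** on the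
't Hooft window `2nβ/N ≤ 1/4`: `log(2N/β) − log(16n) ≤ σ(μ) ≤ log(2N/β) + 2n(2n+3)Nβ` (floor: Bakry–Émery, `suN_stringTension_ge_log`).
[folklore] -/
theorem suN_stringTension_two_sided_linear (hN : 3 ≤ N) (hn : 1 ≤ n) {β : ℝ} (hβ : 0 < β) (hR : β / N * (2 * (n : ℝ)) ≤ 1 / 4)
    {μ : Measure (LGConfig (n + 1) (SUN N))}
    (hμ : haveI : NeZero (n + 1) := ⟨by omega⟩; μ ∈ infiniteVolumeLimitPoints (fundamentalRep (Fin N)) β) :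
    haveI : NeZero (n + 1) := ⟨by omega⟩
    Real.log (2 * N / β) - Real.log (16 * n) ≤ stringTension μ (fun g => normalisedCharacter N (fundamentalRep (Fin N) g)) ∧
      stringTension μ (fun g => normalisedCharacter N (fundamentalRep (Fin N) g)) ≤
        Real.log (2 * N / β) + 2 * n * (2 * n + 3) * N * β := by
  haveI : NeZero (n + 1) := ⟨by omega⟩
  have hN0 : (0 : ℝ) < N := by exact_mod_cast (show 0 < N by omega)
  have hn0 : (0 : ℝ) < n := by exact_mod_cast (show 0 < n by omega)
  obtain ⟨hlow, -⟩ := suN_stringTension_two_sided (n := n) (by omega) hn hβ hR hμ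
  obtain ⟨-, hup⟩ := suN_stringTension_le_log_linear (n := n) (by omega) hn hβ hμ
  have e : Real.log (2 * N / β) - Real.log (16 * n) = Real.log (N / β) - Real.log (8 * n) := by
    have e1 : Real.log (2 * N / β) = Real.log 2 + Real.log (N / β) := by
      rw [← Real.log_mul (by norm_num) (by positivity)]; congr 1; ring
    have e2 : Real.log (16 * (n : ℝ)) = Real.log 2 + Real.log (8 * n) := by
      rw [← Real.log_mul (by norm_num) (by positivity)]; congr 1; ring
    rw [e1, e2]; ring
  rw [e]
  exact ⟨hlow, hup⟩

/-- ★ **Every `N ≥ 3`, `d = 4`: `log(2N/β) − log 48 ≤ σ(μ) ≤ log(2N/β) + 54Nβ`** for every infinite-volume limit state at every tree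
coupling `0 < β ≤ N/24` (`log(2N/β) = log(2N²/β_W)` is the leading term of the `SU(N)` strong-coupling series). [folklore] -/
theorem suN_stringTension_two_sided_linear_dim4 (hN : 3 ≤ N) {β : ℝ} (hβ : 0 < β) (hβ1 : β ≤ N / 24)
    {μ : Measure (LGConfig 4 (SUN N))} (hμ : μ ∈ infiniteVolumeLimitPoints (fundamentalRep (Fin N)) β) :
    Real.log (2 * N / β) - Real.log 48 ≤ stringTension μ (fun g => normalisedCharacter N (fundamentalRep (Fin N) g)) ∧
      stringTension μ (fun g => normalisedCharacter N (fundamentalRep (Fin N) g)) ≤ Real.log (2 * N / β) + 54 * N * β := by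
  have hN0 : (0 : ℝ) < N := by exact_mod_cast (show 0 < N by omega)
  have hR : β / N * (2 * ((3 : ℕ) : ℝ)) ≤ 1 / 4 := by
    push_cast
    rw [div_mul_eq_mul_div, div_le_iff₀ hN0]
    linarith
  obtain ⟨hlow, hup⟩ := suN_stringTension_two_sided_linear (n := 3) hN (by norm_num) hβ hR hμ
  push_cast at hlow hup
  have e : (16 : ℝ) * 3 = 48 := by norm_num
  rw [e] at hlow
  exact ⟨hlow, by linarith⟩

/-! ### `SU(2)`: `σ(μ) ≤ log(4/β_W) + 2n(2n+3)β_W` at every coupling; the two-sided law with a vanishing ceiling loss -/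

/-- **SU(2), dimension `n + 1 ≥ 2`: `−log W_μ(1,1) ≤ log(4/β_W) + 2n(2n+3)β_W`** for every `β_W > 0` and every infinite-volume limit
state at tree coupling `β_W/2` (`V₀(SU(2)) = 1`; `β_W/4 = u` is the leading term of `W(1,1) = I₂(β_W)/I₁(β_W)`). [folklore] -/
theorem su2_neg_log_plaquette_le_linear (hn : 1 ≤ n) {βW : ℝ} (hβ : 0 < βW) {μ : Measure (LGConfig (n + 1) (SUN 2))}
    (hμ : haveI : NeZero (n + 1) := ⟨by omega⟩; μ ∈ infiniteVolumeLimitPoints (fundamentalRep (Fin 2)) (βW / 2)) :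
    haveI : NeZero (n + 1) := ⟨by omega⟩
    (-Real.log (rectExpectation μ (fun g => normalisedCharacter 2 (fundamentalRep (Fin 2) g)) 0 1 1 1)) ≤
      Real.log (4 / βW) + 2 * n * (2 * n + 3) * βW := by
  haveI : NeZero (n + 1) := ⟨by omega⟩
  have hρ := TorusAreaLaw.isSpecialUnitaryModel_fundamentalRep 2
  have h := neg_log_plaquette_le_linear_of_model (d := n + 1) (fundamentalRep (Fin 2)) hρ le_rfl (by omega)
    (by positivity : 0 < βW / 2) hμ
  rw [HaarSecondMoments.charVariance_su2] at h
  have hd : ((n + 1 : ℕ) : ℝ) - 1 = n := by push_cast; ring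
  have hd' : (2 : ℝ) * ((n + 1 : ℕ) : ℝ) + 1 = 2 * n + 3 := by push_cast; ring
  rw [hd, hd'] at h
  have e1 : ((2 : ℕ) : ℝ) / (βW / 2 * 1) = 4 / βW := by push_cast; field_simp; ring
  have e2 : 2 * (n : ℝ) * (2 * n + 3) * (2 : ℕ) * (βW / 2) = 2 * n * (2 * n + 3) * βW := by push_cast; ring
  rw [e1, e2] at h
  exact h

/-- ★★ **SU(2) CEILING WITHOUT A CONSTANT**: `σ(μ) ≤ log(4/β_W) + 2n(2n+3)β_W` for every `β_W > 0` and every infinite-volume limit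
state (dimension `n + 1 ≥ 2`). [folklore] -/
theorem su2_stringTension_le_log4_linear (hn : 1 ≤ n) {βW : ℝ} (hβ : 0 < βW) {μ : Measure (LGConfig (n + 1) (SUN 2))}
    (hμ : haveI : NeZero (n + 1) := ⟨by omega⟩; μ ∈ infiniteVolumeLimitPoints (fundamentalRep (Fin 2)) (βW / 2)) :
    haveI : NeZero (n + 1) := ⟨by omega⟩
    stringTension μ (fun g => normalisedCharacter 2 (fundamentalRep (Fin 2) g)) ≤ Real.log (4 / βW) + 2 * n * (2 * n + 3) * βW := by
  haveI : NeZero (n + 1) := ⟨by omega⟩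
  have hρ := TorusAreaLaw.isSpecialUnitaryModel_fundamentalRep 2
  obtain ⟨-, -, hle, -⟩ := WilsonStringTension.stringTension_le (d := n + 1) (fundamentalRep (Fin 2)) hρ le_rfl
    (by omega) (by positivity : 0 < βW / 2) hμ
  exact hle.trans (su2_neg_log_plaquette_le_linear hn hβ hμ)

/-- ★★ **SU(2), `d = 4`: `σ(μ) ≤ log(4/β_W) + 54β_W` at EVERY `β_W > 0`, every infinite-volume limit state.** [folklore] -/
theorem su2_stringTension_le_log4_linear_dim4 {βW : ℝ} (hβ : 0 < βW) {μ : Measure (LGConfig 4 (SUN 2))}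
    (hμ : μ ∈ infiniteVolumeLimitPoints (fundamentalRep (Fin 2)) (βW / 2)) :
    stringTension μ (fun g => normalisedCharacter 2 (fundamentalRep (Fin 2) g)) ≤ Real.log (4 / βW) + 54 * βW := by
  have h := su2_stringTension_le_log4_linear (n := 3) (by norm_num) hβ hμ
  push_cast at h
  linarith

/-- ★ **SU(2), `d = 3`: `σ(μ) ≤ log(4/β_W) + 28β_W` at every `β_W > 0`, every infinite-volume limit state.** [folklore] -/
theorem su2_stringTension_le_log4_linear_dim3 {βW : ℝ} (hβ : 0 < βW) {μ : Measure (LGConfig 3 (SUN 2))}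
    (hμ : μ ∈ infiniteVolumeLimitPoints (fundamentalRep (Fin 2)) (βW / 2)) :
    stringTension μ (fun g => normalisedCharacter 2 (fundamentalRep (Fin 2) g)) ≤ Real.log (4 / βW) + 28 * βW := by
  have h := su2_stringTension_le_log4_linear (n := 2) (by norm_num) hβ hμ
  push_cast at h
  linarith

/-- ★★ **SU(2): THE TWO-SIDED LAW WITH A VANISHING CEILING LOSS** (dimension `n + 1 ≥ 2`, `0 < β_W ≤ 2/n`), every infinite-volume
limit state: `log(4/β_W) − log(2n) ≤ σ(μ) ≤ log(4/β_W) + 2n(2n+3)β_W`. [folklore] -/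
theorem su2_stringTension_two_sided_linear (hn : 1 ≤ n) {βW : ℝ} (hβ : 0 < βW) (hβ1 : (n : ℝ) * βW ≤ 2)
    {μ : Measure (LGConfig (n + 1) (SUN 2))}
    (hμ : haveI : NeZero (n + 1) := ⟨by omega⟩; μ ∈ infiniteVolumeLimitPoints (fundamentalRep (Fin 2)) (βW / 2)) :
    haveI : NeZero (n + 1) := ⟨by omega⟩
    Real.log (4 / βW) - Real.log (2 * n) ≤ stringTension μ (fun g => normalisedCharacter 2 (fundamentalRep (Fin 2) g)) ∧
      stringTension μ (fun g => normalisedCharacter 2 (fundamentalRep (Fin 2) g)) ≤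
        Real.log (4 / βW) + 2 * n * (2 * n + 3) * βW :=
  ⟨(su2_stringTension_two_sided_sharp hn hβ hβ1 hμ).1, su2_stringTension_le_log4_linear hn hβ hμ⟩

/-- ★★ **SU(2), `d = 4`: `log(4/β_W) − log 6 ≤ σ(μ) ≤ log(4/β_W) + 54β_W` for every infinite-volume limit state at every
`0 < β_W ≤ 2/3`** — above Wilson's leading term the deviation is `O(β_W)`; the `log 6` below is the Dobrushin door's. [folklore] -/
theorem su2_stringTension_two_sided_linear_dim4 {βW : ℝ} (hβ : 0 < βW) (hβ1 : βW ≤ 2 / 3) {μ : Measure (LGConfig 4 (SUN 2))}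
    (hμ : μ ∈ infiniteVolumeLimitPoints (fundamentalRep (Fin 2)) (βW / 2)) :
    Real.log (4 / βW) - Real.log 6 ≤ stringTension μ (fun g => normalisedCharacter 2 (fundamentalRep (Fin 2) g)) ∧
      stringTension μ (fun g => normalisedCharacter 2 (fundamentalRep (Fin 2) g)) ≤ Real.log (4 / βW) + 54 * βW := by
  obtain ⟨hlow, -⟩ := su2_stringTension_two_sided_sharp (n := 3) (by norm_num) hβ (by push_cast; linarith) hμ
  push_cast at hlow
  have e : (2 : ℝ) * 3 = 6 := by norm_num
  rw [e] at hlow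
  exact ⟨hlow, su2_stringTension_le_log4_linear_dim4 hβ hμ⟩

/-- ★ **SU(2), `d = 3`: `log(4/β_W) − log 4 ≤ σ(μ) ≤ log(4/β_W) + 28β_W`** for every infinite-volume limit state at every
`0 < β_W ≤ 1`. [folklore] -/
theorem su2_stringTension_two_sided_linear_dim3 {βW : ℝ} (hβ : 0 < βW) (hβ1 : βW ≤ 1) {μ : Measure (LGConfig 3 (SUN 2))}
    (hμ : μ ∈ infiniteVolumeLimitPoints (fundamentalRep (Fin 2)) (βW / 2)) :
    Real.log (4 / βW) - Real.log 4 ≤ stringTension μ (fun g => normalisedCharacter 2 (fundamentalRep (Fin 2) g)) ∧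
      stringTension μ (fun g => normalisedCharacter 2 (fundamentalRep (Fin 2) g)) ≤ Real.log (4 / βW) + 28 * βW := by
  obtain ⟨hlow, -⟩ := su2_stringTension_two_sided_sharp (n := 2) (by norm_num) hβ (by push_cast; linarith) hμ
  push_cast at hlow
  have e : (2 : ℝ) * 2 = 4 := by norm_num
  rw [e] at hlow
  exact ⟨hlow, su2_stringTension_le_log4_linear_dim3 hβ hμ⟩

/-- ★ **SU(2), `d = 4`, both ceilings at once**: `σ(μ) − log(4/β_W) ≤ min(log 6 + 24β_W, 54β_W)` for every infinite-volume limit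
state at every `β_W > 0` (g5's sharp ceiling and the linear one). [folklore] -/
theorem su2_stringTension_sub_log4_le_min_dim4 {βW : ℝ} (hβ : 0 < βW) {μ : Measure (LGConfig 4 (SUN 2))}
    (hμ : μ ∈ infiniteVolumeLimitPoints (fundamentalRep (Fin 2)) (βW / 2)) :
    stringTension μ (fun g => normalisedCharacter 2 (fundamentalRep (Fin 2) g)) - Real.log (4 / βW) ≤
      min (Real.log 6 + 24 * βW) (54 * βW) := by
  have h1 := su2_stringTension_le_log_sharp (n := 3) (by norm_num) hβ hμ
  have h2 := su2_stringTension_le_log4_linear_dim4 hβ hμ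
  push_cast at h1
  have e : Real.log (8 * 3 / βW) = Real.log (4 / βW) + Real.log 6 := by
    rw [← Real.log_mul (by positivity) (by norm_num)]; congr 1; ring
  rw [e] at h1
  refine le_min ?_ ?_ <;> linarith

/-- ★★ **SU(2), `d = 4`: THE CEILING-SIDE LOSS VANISHES AS `β_W → 0`, uniformly over the limit states**:
`∀ ε > 0, ∃ β₀ > 0, ∀ β_W ∈ (0, β₀], ∀ μ, σ(μ) ≤ log(4/β_W) + ε` (`β₀ = ε/54`), i.e. `limsup_{β_W → 0} sup_μ (σ(μ) − log(4/β_W)) ≤ 0`.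
[folklore] -/
theorem su2_stringTension_ceiling_limit_dim4 (ε : ℝ) (hε : 0 < ε) :
    ∃ β₀ : ℝ, 0 < β₀ ∧ ∀ βW : ℝ, 0 < βW → βW ≤ β₀ →
      ∀ μ ∈ infiniteVolumeLimitPoints (d := 4) (fundamentalRep (Fin 2)) (βW / 2),
        stringTension μ (fun g => normalisedCharacter 2 (fundamentalRep (Fin 2) g)) ≤ Real.log (4 / βW) + ε := by
  refine ⟨ε / 54, by positivity, fun βW hβ hβ0 μ hμ => ?_⟩
  have h := su2_stringTension_le_log4_linear_dim4 hβ hμ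
  have : 54 * βW ≤ ε := by
    have := mul_le_mul_of_nonneg_left hβ0 (by norm_num : (0 : ℝ) ≤ 54)
    linarith [this]
  linarith

/-! ### `SU(2)`: the static quark potential with the slope ceiling `log(4/β_W) + 2n(2n+3)β_W` -/

/-- ★ **SU(2), dimension `n + 1 ≥ 2`: `V_μ(R) ≤ (log(4/β_W) + 2n(2n+3)β_W)·R`** for every `R`, every `β_W > 0`, every infinite-volume
limit state. [folklore] -/
theorem su2_staticPotential_le_log4_linear (hn : 1 ≤ n) {βW : ℝ} (hβ : 0 < βW) {μ : Measure (LGConfig (n + 1) (SUN 2))}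
    (hμ : haveI : NeZero (n + 1) := ⟨by omega⟩; μ ∈ infiniteVolumeLimitPoints (fundamentalRep (Fin 2)) (βW / 2)) (R : ℕ) :
    haveI : NeZero (n + 1) := ⟨by omega⟩
    staticPotential μ (fun g => normalisedCharacter 2 (fundamentalRep (Fin 2) g)) R ≤
      (Real.log (4 / βW) + 2 * n * (2 * n + 3) * βW) * R := by
  haveI : NeZero (n + 1) := ⟨by omega⟩
  have hρ := TorusAreaLaw.isSpecialUnitaryModel_fundamentalRep 2
  have hW := WilsonStringTension.rectExpectation_ne_zero (d := n + 1) (fundamentalRep (Fin 2)) hρ le_rfl (by omega)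
    (by positivity : 0 < βW / 2) hμ
  have hc : Continuous (fundamentalRep (Fin 2) : SUN 2 → Matrix (Fin 2) (Fin 2) ℂ) := continuous_fundamentalRep (Fin 2)
  have h1 := StaticPotential.staticPotential_le_mul (fundamentalRep (Fin 2)) (by omega) hc (by positivity : (0 : ℝ) ≤ βW / 2)
    hμ hW R
  have h2 := StaticPotential.staticPotential_le_neg_log (fundamentalRep (Fin 2)) (by omega) hc
    (by positivity : (0 : ℝ) ≤ βW / 2) hμ hW 1
  have h3 := su2_neg_log_plaquette_le_linear hn hβ hμ
  have hR : (0 : ℝ) ≤ R := Nat.cast_nonneg R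
  calc staticPotential μ (fun g => normalisedCharacter 2 (fundamentalRep (Fin 2) g)) R
      ≤ R * staticPotential μ (fun g => normalisedCharacter 2 (fundamentalRep (Fin 2) g)) 1 := h1
    _ ≤ R * (Real.log (4 / βW) + 2 * n * (2 * n + 3) * βW) := mul_le_mul_of_nonneg_left (h2.trans h3) hR
    _ = _ := by ring

/-- ★★ **SU(2), `d = 4`: `log(2/(3β_W))·R − 2·log(512/(3β_W)) ≤ V_μ(R) ≤ (log(4/β_W) + 54β_W)·R`** for every infinite-volume limit
state at every `0 < β_W ≤ 2/3` and every `R ≥ 1` (slope floor `log(4/β_W) − log 6`, slope ceiling `log(4/β_W) + 54β_W`). [folklore] -/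
theorem su2_staticPotential_two_sided_linear_dim4 {βW : ℝ} (hβ : 0 < βW) (hβ1 : βW ≤ 2 / 3) {μ : Measure (LGConfig 4 (SUN 2))}
    (hμ : μ ∈ infiniteVolumeLimitPoints (fundamentalRep (Fin 2)) (βW / 2)) (R : ℕ) (hR : 1 ≤ R) :
    Real.log (2 / (3 * βW)) * R - 2 * Real.log (512 / (3 * βW)) ≤
        staticPotential μ (fun g => normalisedCharacter 2 (fundamentalRep (Fin 2) g)) R ∧
      staticPotential μ (fun g => normalisedCharacter 2 (fundamentalRep (Fin 2) g)) R ≤ (Real.log (4 / βW) + 54 * βW) * R := by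
  obtain ⟨hlow, -⟩ := su2_staticPotential_two_sided_dim4 hβ hβ1 hμ R hR
  have hup := su2_staticPotential_le_log4_linear (n := 3) (by norm_num) hβ hμ R
  push_cast at hup
  have e : (2 : ℝ) * 3 * (2 * 3 + 3) * βW = 54 * βW := by ring
  rw [e] at hup
  exact ⟨hlow, hup⟩

/-! ### `SU(3)`, `d = 4`: `σ(μ) ≤ log(18/β_W) + 54β_W` -/

/-- ★ **SU(3), `d = 4`: `σ(μ) ≤ log(18/β_W) + 54β_W`** for every `β_W > 0` and every infinite-volume limit state at tree coupling
`β_W/3` (`log(18/β_W) = log(1/u)`, `u = β_W/(2·3²)` the leading term; g5: `log(108/β_W) + 24β_W`), and the HYPOTHESIS-FREE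
two-sided law `log((3 − 4β_W)/(4β_W)) ≤ σ(μ) ≤ log(18/β_W) + 54β_W` on `0 < β_W ≤ 3/8`. [folklore] -/
theorem su3_stringTension_le_log18_linear_dim4 {βW : ℝ} (hβ : 0 < βW) {μ : Measure (LGConfig 4 (SUN 3))}
    (hμ : μ ∈ infiniteVolumeLimitPoints (fundamentalRep (Fin 3)) (βW / 3)) :
    stringTension μ (fun g => normalisedCharacter 3 (fundamentalRep (Fin 3) g)) ≤ Real.log (18 / βW) + 54 * βW ∧
      (βW ≤ 3 / 8 → Real.log ((3 - 4 * βW) / (4 * βW)) ≤ stringTension μ (fun g => normalisedCharacter 3 (fundamentalRep (Fin 3) g))) := by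
  have h := suN_stringTension_le_log_linear_dim4 (N := 3) (by norm_num) (by positivity : 0 < βW / 3) hμ
  push_cast at h
  have e : (2 : ℝ) * 3 / (βW / 3) = 18 / βW := by field_simp; ring
  have e' : (54 : ℝ) * 3 * (βW / 3) = 54 * βW := by ring
  rw [e, e'] at h
  exact ⟨h, fun hβ1 => (su3_stringTension_ge_log_dim4 hβ hβ1 hμ).2⟩

end StringTensionExplicit

end Summit.Ventures.YMGap.RobustBall
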